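import Literature.MathematicalPhysics.QuantumFieldTheory.Balaban1983to89.T4BankAgeYoung
import Literature.MathematicalPhysics.QuantumFieldTheory.Balaban1983to89.T4MatchingClosureFed

/-!
# `Balaban1983to89.T4MatchingClosureYoung` — the node-U5 closure WITH LEMMA Y's CANONICAL YOUNG WINDOW: the window
binder `hW : SublinearWindow W` DISCHARGED BY NAME (cell `pub-balaban`, T4-DAG v12 §5 rows T4-U5.E-CLOSE*-REMW /
T4-U5.E-CLOSE*-FED / T4-U5.E-REM-LEMMAY-K*; journal self-row T4-U5.E-CLOSE*-YOUNG; record `t4/T4-EST-U5.md` v1.11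
§0 (o))

HONEST FRAMING (cell `pub-balaban`, T4-DAG PAGE 1).  The cell's T4 target is the existence AND uniqueness of the
continuum limit of Bałaban's unit-scale averaged loop expectations on a finite torus — strictly beyond ultraviolet
stability ([Balaban1989LargeFieldII] Thm 1 p. 355); it is NOT the Yang–Mills mass gap and NOT the Clay problem.  This
module is KERNEL BOOKKEEPING ONLY (one-line compositions and `θ`-power arithmetic; 0 estimates).  It is the SEAM between
two landed leaves of different lineages, written BY NAME and deliberately kept out of both (each stays import-minimal):
* the CONSUMER — the node-U5 closure with an ABSTRACT sub-linear young allowance `W : ℕ → ℕ`,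
  `T4MatchingClosureRem.hybridNE7_closure_remnantW` / `stringHybridNE7_closure_remnantW` (unit `b2b-balaban-pv02` gen 8,
  p181923) and its per-step-fed form `T4MatchingClosureFed.hybridNE7_closure_fed_steps` /
  `stringHybridNE7_closure_fed_steps` (gen 11, p183279), all carrying the binder `hW : SublinearWindow W`;
* the PRODUCER of the window — Lemma Y's arithmetic `T4BankAgeYoung` (unit `b2b-balaban-pv25` gen 6, p182815): the
  canonical ℕ-valued window `youngWindow d L r C_g C′ x̄ c̄ K = ⌈A(K)·N′_K(A(K))⌉₊` is `PolylogWindow _ (max r 1 + 1)`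
  (`polylogWindow_youngWindow`, binders `1 ≤ C_g`, `0 ≤ C′`, `0 ≤ x̄`, `0 ≤ c̄`), hence sub-linear
  (`T4MatchingClosureRem.PolylogWindow.sublinear`), and a sub-history ledger obeying Lemma Y's hypotheses at cutoff `K`
  has lifetime `< youngWindow … K` (`lifetime_lt_youngWindow`).

WHAT THIS LEAF DOES, EXACTLY (no over-claim).  (§1) `0 ≤ C′` is READ OFF the age-cut inequality
`hq : ⌈C·log Λ⌉₊ + 3 ≤ C′·(−log ρ)` already carried by the closure (`0 < ρ < 1`), so the window discharge adds NO binder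
on `C′`.  (§2) The closure theorems with `W := youngWindow d L r C_g C′ x̄ c̄` and the old-born profile the SATURATING
one `remOld := fun _ n ↦ E₀·ρⁿ` (`T4RemnantBooking.remnantAgeBound_saturated`): binders `hW`, `hRem` GONE, replaced by
the three Lemma-Y side-parameter signs `1 ≤ C_g`, `0 ≤ x̄`, `0 ≤ c̄`; every other binder and the conclusion are those
of `hybridNE7_closure_remnantW` / `stringHybridNE7_closure_remnantW`, letter for letter.  (§3) The same substitution in
the per-step-fed forms (`…_fed_steps`), whose remnant binders then read: `1 ≤ Λ`, `0 ≤ E`, `0 < ρ < 1`, `hq`,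
`0 < θ < 1`, `1 ≤ C_g`, `0 ≤ x̄`, `0 ≤ c̄`, the split budget `hSB` and the per-term step data `hsteps` (a `StepBudget` at
the canonical window).  (§4) THE RATE SEAM, arithmetic only: the young RATE clause of `StepBudget`
(`r_j ≤ C_r·θ^j·θ^{−W(K)}`) is what a birth-step rate `C_r·θ^b` becomes when the sub-history met at step `j` was born
at `b` with `j ≤ b + W(K)` (`pow_birth_le_windowRate`, `0 < θ ≤ 1`), and `j ≤ b + W(K)` is what Lemma Y's conclusion
SHAPE (lifetime, as a real-cast sum of epoch lengths, `< youngWindow … K`) gives together with the covering binder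
`j ≤ b + lifetime` (`step_le_birth_add_window`, `youngRate_of_lifetime_lt`, and BY NAME from `lifetime_lt_youngWindow`:
`youngRate_of_lifetime_lt_youngWindow`).  (§5) Non-vacuity: the discharged binders are jointly satisfiable.

NOT DONE HERE (the producers' obligations; NOT PRINTED; proved nowhere in the tree): that Bałaban's young remnant
activities carry a two-run rate `C_r·θ^{birth step}` at the activity level (cell nodes NE-R1 two-run half / NE2⁺-LF /
U5a; print's one-run bounds [Balaban1989LargeFieldII] (1.97)–(1.100) p. 390 are the age-free case — LOCATIONS only,
nothing quoted); that Bałaban's sub-histories satisfy the DATA hypotheses of `T4BankAgeYoung.lifetime_lt_youngWindow`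
(record `t4/T4-EST-U5E-rem.md` v1.1 §4, Lemma Y — cell analysis; the bank constants, the size potential, the halving
profile and the typed (2.5) windows are BINDERS there and stay binders here); the seven non-remnant fields of the budget
(rows T4-U5.E-b / E-b-R1 / E-c); the per-step two-summand budget itself (the conclusion SHAPE of unit `b2b-balaban-pv05`
gen 10's `T4TwoRunRateAssembly.leafSum_remnant_radius_le_young_add_old`, proposal p182873 — NOT imported, nothing of it
used).  No `RemnantSplitBudget` / `StepBudget` is INSTANTIATED for Bałaban's objects in this module: both occur only as
binders (cell ABSOLUTE RULE; lineage handoff (R3)).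

ABSOLUTE RULE.  Nothing of [Balaban1989LargeFieldII] is asserted; no `[cite:]` tag; page numbers are LOCATIONS.  Every
declaration is [folklore] bookkeeping over `T4MatchingClosureRem` §5–§7, `T4MatchingClosureFed` §3–§4b, `T4BankAgeYoung`
§6–§7 and `T4RemnantBooking` §4.  Rung-(B)+1 value = the user-facing binder list of node U5 with the young-window
binder resolved BY NAME to Lemma Y's side parameters; NOT an estimate, NOT summit progress.  Unit `b2b-balaban-pv02`
gen 12 (journal CLAIM T4-U5.E-CLOSE*-YOUNG 2026-08-19T04:27:02Z; the composition was first kernel-checked as the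
lineage's gen-11 scratch probe `ProbeSeamYoung`).
-/

open Finset

namespace Literature.MathematicalPhysics.QuantumFieldTheory.Balaban1983to89.T4MatchingClosureYoung

open T4CauchySum T4GoodClassBudget T4HistoryPeeling T4MatchingAssembly T4MatchingClosure T4RemnantBooking
  T4MatchingClosureRem T4MatchingClosureFed T4BankAgeYoung

/-! ## §1 The age-cut constant is non-negative under `hq` -/

section AgeCut

/-- `0 ≤ C′` is forced by the age-cut inequality `⌈C·log Λ⌉₊ + 3 ≤ C′·(−log ρ)` when `0 < ρ < 1` (the left side is
`≥ 3 > 0` and `−log ρ > 0`). [folklore] -/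
theorem ageCutConst_nonneg_of_hq {C C' Λ ρ : ℝ} (hρ0 : 0 < ρ) (hρ1 : ρ < 1)
    (hq : ((⌈C * Real.log Λ⌉₊ : ℕ) : ℝ) + 3 ≤ C' * (-Real.log ρ)) : 0 ≤ C' := by
  have hl : 0 < -Real.log ρ := by have := Real.log_neg hρ0 hρ1; linarith
  have h3 : (0 : ℝ) ≤ ((⌈C * Real.log Λ⌉₊ : ℕ) : ℝ) := Nat.cast_nonneg _
  by_contra h
  have : C' * (-Real.log ρ) < 0 := mul_neg_of_neg_of_pos (lt_of_not_ge h) hl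
  linarith

/-- … so under `hq` the canonical young window is sub-linear with NO further condition on `C′`
(`T4BankAgeYoung.polylogWindow_youngWindow`, `T4MatchingClosureRem.PolylogWindow.sublinear`). [folklore] -/
theorem sublinearWindow_youngWindow_of_hq {C C' Λ ρ Cg x c : ℝ} (d L r : ℕ) (hρ0 : 0 < ρ) (hρ1 : ρ < 1)
    (hq : ((⌈C * Real.log Λ⌉₊ : ℕ) : ℝ) + 3 ≤ C' * (-Real.log ρ)) (hCg : 1 ≤ Cg) (hx : 0 ≤ x) (hc : 0 ≤ c) :
    SublinearWindow (youngWindow d L r Cg C' x c) :=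
  (polylogWindow_youngWindow d L r hCg (ageCutConst_nonneg_of_hq hρ0 hρ1 hq) hx hc).sublinear

end AgeCut

/-! ## §2 The closure with the canonical young window and the saturating old profile -/

section ClosureYoung

variable {ι : Type*} [DecidableEq ι] {l₀ vol : ℝ} {T : ℕ → Finset ι} {A B Acore Bcore : ℕ → ℝ → ι → ℝ}
  {Bad : ℕ → ℝ → Finset ι} {Cc Rr CcRec RrRec : ℕ → ℝ → ι → ℝ} {ν u' s₂ c₀ r' s L : ℕ → ℝ}
  {Λ C' E₀ ρ θ Cy Cg x c : ℝ} {d Lb rr : ℕ}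

/-- **THE NODE-U5 CLOSURE WITH LEMMA Y's CANONICAL YOUNG WINDOW** (= `T4MatchingClosureRem.hybridNE7_closure_remnantW`
at `W := youngWindow d L r C_g C′ x̄ c̄`, `remOld := fun _ n ↦ E₀·ρⁿ`; the binders `hW : SublinearWindow W` and
`hRem : RemnantAgeBound remOld E₀ ρ` DISCHARGED by `sublinearWindow_youngWindow_of_hq` / `remnantAgeBound_saturated`;
new binders: `1 ≤ C_g`, `0 ≤ x̄`, `0 ≤ c̄` only).  Every other binder and the conclusion are those of
`hybridNE7_closure_remnantW`, letter for letter.  CONDITIONAL exactly as that theorem; nothing PRINTED is asserted.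
[folklore] -/
theorem hybridNE7_closure_youngWindow {r₀ V C : ℝ} (h0 : 0 < r₀) (h1 : r₀ < 1) (hV : 0 ≤ V)
    (hC : 1 < C * (-Real.log r₀))
    (hA : ∀ K t, |t| ≤ l₀ → ∀ τ ∈ T K, 0 ≤ A K t τ) (hB : ∀ K t, |t| ≤ l₀ → ∀ τ ∈ T K, 0 ≤ B K t τ)
    (hDA : SlotDom l₀ T A Bad fun K => V * r₀ ^ (K - jlogOf C K))
    (hDB : SlotDom l₀ T B Bad fun K => V * r₀ ^ (K - jlogOf C K))
    (hL0 : ∀ K, 0 ≤ L K) (hLs : Summable L)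
    (hA0 : ∀ K t, |t| ≤ l₀ → ∀ τ ∈ T K, 0 ≤ Acore K t τ)
    (hAlo : ∀ K t, |t| ≤ l₀ → ∀ τ ∈ T K, Acore K t τ ≤ A K t τ)
    (hAhi : ∀ K t, |t| ≤ l₀ → ∀ τ ∈ T K, A K t τ ≤ Real.exp (L K) * Acore K t τ)
    (hB0 : ∀ K t, |t| ≤ l₀ → ∀ τ ∈ T K, 0 ≤ Bcore K t τ)
    (hBlo : ∀ K t, |t| ≤ l₀ → ∀ τ ∈ T K, Bcore K t τ ≤ B K t τ)
    (hBhi : ∀ K t, |t| ≤ l₀ → ∀ τ ∈ T K, B K t τ ≤ Real.exp (L K) * Bcore K t τ)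
    (hΛ : 1 ≤ Λ) (hE : 0 ≤ E₀) (hρ0 : 0 < ρ) (hρ1 : ρ < 1)
    (hq : ((⌈C * Real.log Λ⌉₊ : ℕ) : ℝ) + 3 ≤ C' * (-Real.log ρ)) (hθ : 0 < θ) (hθ1 : θ < 1)
    (hCg : 1 ≤ Cg) (hx : 0 ≤ x) (hc : 0 ≤ c)
    (hTB : ReindexedBudget l₀ vol T Acore Bcore Bad Cc Rr CcRec RrRec ν
      (fun K => u' K + remnantOld (fun _ n => E₀ * ρ ^ n) Λ C C' K) s₂
      c₀ (fun K => r' K + Cy * remnantYoungW θ Λ C (youngWindow d Lb rr Cg C' x c) K) s)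
    (hr : Summable r') (hu : Summable u') (hs : Summable s) (hs₂ : Summable s₂) :
    ∃ K₀, HybridNE7 l₀ vol (fun K => T (K₀ + K)) (fun K => A (K₀ + K)) (fun K => B (K₀ + K)) (fun K => Bad (K₀ + K))
      (fun K => 1 - Real.exp (-(V * r₀ ^ (K₀ + K - jlogOf C (K₀ + K)))))
      (fun K t τ => A (K₀ + K) t τ - Acore (K₀ + K) t τ) (fun K t τ => B (K₀ + K) t τ - Bcore (K₀ + K) t τ)
      (fun K => 1 - Real.exp (-L (K₀ + K)))
      (fun K => ((r' (K₀ + K) + Cy * remnantYoungW θ Λ C (youngWindow d Lb rr Cg C' x c) (K₀ + K)) +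
          (u' (K₀ + K) + remnantOld (fun _ n => E₀ * ρ ^ n) Λ C C' (K₀ + K))) + (s (K₀ + K) + s₂ (K₀ + K))) :=
  hybridNE7_closure_remnantW h0 h1 hV hC hA hB hDA hDB hL0 hLs hA0 hAlo hAhi hB0 hBlo hBhi
    (remnantAgeBound_saturated hE hρ0.le) hΛ hE hρ0 hρ1 hq hθ hθ1
    (sublinearWindow_youngWindow_of_hq d Lb rr hρ0 hρ1 hq hCg hx hc) hTB hr hu hs hs₂

end ClosureYoung

/-! ## §2b Per string, end to end, with the canonical young window -/

section SchemeYoung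

open Missing T4Continuum T4Assembly

variable {G : Type*} [GaugeGroup G] [MeasurableSpace G] [HaarData G] {O : Type*}

/-- **PER STRING, END TO END, WITH LEMMA Y's CANONICAL YOUNG WINDOW** (= `stringHybridNE7_closure_remnantW` at
`W := youngWindow …`, `remOld := fun _ n ↦ E₀·ρⁿ`; `hW`, `hRem` discharged).  USER-FACING BINDER LIST OF NODE U5 after
this leaf: as in `stringHybridNE7_closure_remnantW` with `hW`, `hRem` replaced by `1 ≤ C_g`, `0 ≤ x̄`, `0 ≤ c̄`.
[folklore] -/
theorem stringHybridNE7_closure_youngWindow (S : TorusScheme G O) (os : List O) (K₀ : ℕ) {ι : Type} [DecidableEq ι]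
    {l₀ vol : ℝ} {T : ℕ → Finset ι} {A B Acore Bcore : ℕ → ℝ → ι → ℝ} {Bad : ℕ → ℝ → Finset ι}
    {Cc Rr CcRec RrRec : ℕ → ℝ → ι → ℝ} {ν u' s₂ c₀ r' s L : ℕ → ℝ} {Λ C' E₀ ρ θ Cy Cg x c : ℝ} {d Lb rr : ℕ}
    {r₀ V C : ℝ}
    (h0 : 0 < r₀) (h1 : r₀ < 1) (hV : 0 ≤ V) (hC : 1 < C * (-Real.log r₀))
    (hA : ∀ K t, |t| ≤ l₀ → ∀ τ ∈ T K, 0 ≤ A K t τ) (hB : ∀ K t, |t| ≤ l₀ → ∀ τ ∈ T K, 0 ≤ B K t τ)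
    (hDA : SlotDom l₀ T A Bad fun K => V * r₀ ^ (K - jlogOf C K))
    (hDB : SlotDom l₀ T B Bad fun K => V * r₀ ^ (K - jlogOf C K))
    (hL0 : ∀ K, 0 ≤ L K) (hLs : Summable L)
    (hA0 : ∀ K t, |t| ≤ l₀ → ∀ τ ∈ T K, 0 ≤ Acore K t τ)
    (hAlo : ∀ K t, |t| ≤ l₀ → ∀ τ ∈ T K, Acore K t τ ≤ A K t τ)
    (hAhi : ∀ K t, |t| ≤ l₀ → ∀ τ ∈ T K, A K t τ ≤ Real.exp (L K) * Acore K t τ)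
    (hB0 : ∀ K t, |t| ≤ l₀ → ∀ τ ∈ T K, 0 ≤ Bcore K t τ)
    (hBlo : ∀ K t, |t| ≤ l₀ → ∀ τ ∈ T K, Bcore K t τ ≤ B K t τ)
    (hBhi : ∀ K t, |t| ≤ l₀ → ∀ τ ∈ T K, B K t τ ≤ Real.exp (L K) * Bcore K t τ)
    (hΛ : 1 ≤ Λ) (hE : 0 ≤ E₀) (hρ0 : 0 < ρ) (hρ1 : ρ < 1)
    (hq : ((⌈C * Real.log Λ⌉₊ : ℕ) : ℝ) + 3 ≤ C' * (-Real.log ρ)) (hθ : 0 < θ) (hθ1 : θ < 1)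
    (hCg : 1 ≤ Cg) (hx : 0 ≤ x) (hc : 0 ≤ c)
    (hTB : ReindexedBudget l₀ vol T Acore Bcore Bad Cc Rr CcRec RrRec ν
      (fun K => u' K + remnantOld (fun _ n => E₀ * ρ ^ n) Λ C C' K) s₂
      c₀ (fun K => r' K + Cy * remnantYoungW θ Λ C (youngWindow d Lb rr Cg C' x c) K) s)
    (hr : Summable r') (hu : Summable u') (hs : Summable s) (hs₂ : Summable s₂)
    (hZA : ∀ K t, |t| ≤ l₀ → T4GenFunBounds.schemeZ S os (K₀ + K) t = ∑ τ ∈ T K, A K t τ)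
    (hZB : ∀ K t, |t| ≤ l₀ → T4GenFunBounds.schemeZ S os (K₀ + K + 1) t = ∑ τ ∈ T K, B K t τ) :
    ∃ K₁, StringHybridNE7 S os l₀ vol (K₀ + K₁) :=
  stringHybridNE7_closure_remnantW S os K₀ h0 h1 hV hC hA hB hDA hDB hL0 hLs hA0 hAlo hAhi hB0 hBlo hBhi
    (remnantAgeBound_saturated hE hρ0.le) hΛ hE hρ0 hρ1 hq hθ hθ1
    (sublinearWindow_youngWindow_of_hq d Lb rr hρ0 hρ1 hq hCg hx hc) hTB hr hu hs hs₂ hZA hZB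

end SchemeYoung

/-! ## §3 The per-step-fed closure with the canonical young window -/

section FedYoung

variable {ι : Type*} [DecidableEq ι] {l₀ vol : ℝ} {T : ℕ → Finset ι} {A B Acore Bcore : ℕ → ℝ → ι → ℝ}
  {Bad : ℕ → ℝ → Finset ι} {Cc Rr CcRec RrRec RrRem : ℕ → ℝ → ι → ℝ} {ν u' s₂ c₀ r' s L : ℕ → ℝ}
  {Λ C' ρ θ E Cr Cg x c : ℝ} {d Lb rr : ℕ}

/-- **THE NODE-U5 CLOSURE FED FROM PER-STEP DATA, AT LEMMA Y's CANONICAL YOUNG WINDOW**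
(= `T4MatchingClosureFed.hybridNE7_closure_fed_steps` at `W := youngWindow d L r C_g C′ x̄ c̄`, binder `hW` DISCHARGED
by `sublinearWindow_youngWindow_of_hq`).  The user-facing remnant binders are now: `1 ≤ Λ`, `0 ≤ E`, `0 < ρ < 1`,
`⌈C log Λ⌉₊ + 3 ≤ C′(−log ρ)`, `0 < θ < 1`, `1 ≤ C_g`, `0 ≤ x̄`, `0 ≤ c̄`, the split budget `hSB` and the step data
`hsteps` (a `StepBudget` at the canonical window — a BINDER, instantiated for nothing).  CONDITIONAL; nothing PRINTED is
asserted. [folklore] -/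
theorem hybridNE7_closure_fed_steps_youngWindow {r₀ V C : ℝ} (h0 : 0 < r₀) (h1 : r₀ < 1) (hV : 0 ≤ V)
    (hC : 1 < C * (-Real.log r₀))
    (hA : ∀ K t, |t| ≤ l₀ → ∀ τ ∈ T K, 0 ≤ A K t τ) (hB : ∀ K t, |t| ≤ l₀ → ∀ τ ∈ T K, 0 ≤ B K t τ)
    (hDA : SlotDom l₀ T A Bad fun K => V * r₀ ^ (K - jlogOf C K))
    (hDB : SlotDom l₀ T B Bad fun K => V * r₀ ^ (K - jlogOf C K))
    (hL0 : ∀ K, 0 ≤ L K) (hLs : Summable L)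
    (hA0 : ∀ K t, |t| ≤ l₀ → ∀ τ ∈ T K, 0 ≤ Acore K t τ)
    (hAlo : ∀ K t, |t| ≤ l₀ → ∀ τ ∈ T K, Acore K t τ ≤ A K t τ)
    (hAhi : ∀ K t, |t| ≤ l₀ → ∀ τ ∈ T K, A K t τ ≤ Real.exp (L K) * Acore K t τ)
    (hB0 : ∀ K t, |t| ≤ l₀ → ∀ τ ∈ T K, 0 ≤ Bcore K t τ)
    (hBlo : ∀ K t, |t| ≤ l₀ → ∀ τ ∈ T K, Bcore K t τ ≤ B K t τ)
    (hBhi : ∀ K t, |t| ≤ l₀ → ∀ τ ∈ T K, B K t τ ≤ Real.exp (L K) * Bcore K t τ)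
    (hΛ : 1 ≤ Λ) (hE : 0 ≤ E) (hρ0 : 0 < ρ) (hρ1 : ρ < 1)
    (hq : ((⌈C * Real.log Λ⌉₊ : ℕ) : ℝ) + 3 ≤ C' * (-Real.log ρ)) (hθ : 0 < θ) (hθ1 : θ < 1)
    (hCg : 1 ≤ Cg) (hx : 0 ≤ x) (hc : 0 ≤ c)
    (hSB : RemnantSplitBudget l₀ vol T Acore Bcore Bad Cc Rr CcRec RrRec RrRem ν u' s₂ c₀ r' s)
    (hsteps : ∀ K t, |t| ≤ l₀ → ∀ τ ∈ T K \ Bad K t, ∃ rad ry Qy Qo : ℕ → ℝ,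
      StepBudget C C' θ ρ E Cr vol Λ (youngWindow d Lb rr Cg C' x c) K rad ry Qy Qo ∧
        RrRem K t τ ≤ ∑ j ∈ Icc (jlogOf C K) K, rad j)
    (hr : Summable r') (hu : Summable u') (hs : Summable s) (hs₂ : Summable s₂) :
    ∃ K₀, HybridNE7 l₀ vol (fun K => T (K₀ + K)) (fun K => A (K₀ + K)) (fun K => B (K₀ + K)) (fun K => Bad (K₀ + K))
      (fun K => 1 - Real.exp (-(V * r₀ ^ (K₀ + K - jlogOf C (K₀ + K)))))
      (fun K t τ => A (K₀ + K) t τ - Acore (K₀ + K) t τ) (fun K t τ => B (K₀ + K) t τ - Bcore (K₀ + K) t τ)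
      (fun K => 1 - Real.exp (-L (K₀ + K)))
      (fun K => ((r' (K₀ + K) + (E * Cr) * remnantYoungW θ Λ C (youngWindow d Lb rr Cg C' x c) (K₀ + K)) +
          (u' (K₀ + K) + remnantOld (fun _ n => 2 * E * ρ ^ n) Λ C C' (K₀ + K))) + (s (K₀ + K) + s₂ (K₀ + K))) :=
  hybridNE7_closure_fed_steps h0 h1 hV hC hA hB hDA hDB hL0 hLs hA0 hAlo hAhi hB0 hBlo hBhi hΛ hE hρ0 hρ1 hq hθ hθ1
    (sublinearWindow_youngWindow_of_hq d Lb rr hρ0 hρ1 hq hCg hx hc) hSB hsteps hr hu hs hs₂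

end FedYoung

/-! ## §3b Per string, end to end, fed, with the canonical young window -/

section SchemeFedYoung

open Missing T4Continuum T4Assembly

variable {G : Type*} [GaugeGroup G] [MeasurableSpace G] [HaarData G] {O : Type*}

/-- **PER STRING, END TO END, FED FROM PER-STEP DATA, AT LEMMA Y's CANONICAL YOUNG WINDOW**
(= `T4MatchingClosureFed.stringHybridNE7_closure_fed_steps` at `W := youngWindow …`, `hW` discharged).  USER-FACING
BINDER LIST OF NODE U5 after this leaf and `T4MatchingClosureFed`: weight/shell halves, `hq`, `0 < θ < 1`, the Lemma-Y
side-parameter signs `1 ≤ C_g`, `0 ≤ x̄`, `0 ≤ c̄`, the split budget `hSB` (seven clauses, remnants excluded), the step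
data `hsteps`, four summable producer rates, and the two partition-function identifications. [folklore] -/
theorem stringHybridNE7_closure_fed_steps_youngWindow (S : TorusScheme G O) (os : List O) (K₀ : ℕ) {ι : Type}
    [DecidableEq ι] {l₀ vol : ℝ} {T : ℕ → Finset ι} {A B Acore Bcore : ℕ → ℝ → ι → ℝ} {Bad : ℕ → ℝ → Finset ι}
    {Cc Rr CcRec RrRec RrRem : ℕ → ℝ → ι → ℝ} {ν u' s₂ c₀ r' s L : ℕ → ℝ}
    {Λ C' ρ θ E Cr Cg x c : ℝ} {d Lb rr : ℕ} {r₀ V C : ℝ}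
    (h0 : 0 < r₀) (h1 : r₀ < 1) (hV : 0 ≤ V) (hC : 1 < C * (-Real.log r₀))
    (hA : ∀ K t, |t| ≤ l₀ → ∀ τ ∈ T K, 0 ≤ A K t τ) (hB : ∀ K t, |t| ≤ l₀ → ∀ τ ∈ T K, 0 ≤ B K t τ)
    (hDA : SlotDom l₀ T A Bad fun K => V * r₀ ^ (K - jlogOf C K))
    (hDB : SlotDom l₀ T B Bad fun K => V * r₀ ^ (K - jlogOf C K))
    (hL0 : ∀ K, 0 ≤ L K) (hLs : Summable L)
    (hA0 : ∀ K t, |t| ≤ l₀ → ∀ τ ∈ T K, 0 ≤ Acore K t τ)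
    (hAlo : ∀ K t, |t| ≤ l₀ → ∀ τ ∈ T K, Acore K t τ ≤ A K t τ)
    (hAhi : ∀ K t, |t| ≤ l₀ → ∀ τ ∈ T K, A K t τ ≤ Real.exp (L K) * Acore K t τ)
    (hB0 : ∀ K t, |t| ≤ l₀ → ∀ τ ∈ T K, 0 ≤ Bcore K t τ)
    (hBlo : ∀ K t, |t| ≤ l₀ → ∀ τ ∈ T K, Bcore K t τ ≤ B K t τ)
    (hBhi : ∀ K t, |t| ≤ l₀ → ∀ τ ∈ T K, B K t τ ≤ Real.exp (L K) * Bcore K t τ)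
    (hΛ : 1 ≤ Λ) (hE : 0 ≤ E) (hρ0 : 0 < ρ) (hρ1 : ρ < 1)
    (hq : ((⌈C * Real.log Λ⌉₊ : ℕ) : ℝ) + 3 ≤ C' * (-Real.log ρ)) (hθ : 0 < θ) (hθ1 : θ < 1)
    (hCg : 1 ≤ Cg) (hx : 0 ≤ x) (hc : 0 ≤ c)
    (hSB : RemnantSplitBudget l₀ vol T Acore Bcore Bad Cc Rr CcRec RrRec RrRem ν u' s₂ c₀ r' s)
    (hsteps : ∀ K t, |t| ≤ l₀ → ∀ τ ∈ T K \ Bad K t, ∃ rad ry Qy Qo : ℕ → ℝ,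
      StepBudget C C' θ ρ E Cr vol Λ (youngWindow d Lb rr Cg C' x c) K rad ry Qy Qo ∧
        RrRem K t τ ≤ ∑ j ∈ Icc (jlogOf C K) K, rad j)
    (hr : Summable r') (hu : Summable u') (hs : Summable s) (hs₂ : Summable s₂)
    (hZA : ∀ K t, |t| ≤ l₀ → T4GenFunBounds.schemeZ S os (K₀ + K) t = ∑ τ ∈ T K, A K t τ)
    (hZB : ∀ K t, |t| ≤ l₀ → T4GenFunBounds.schemeZ S os (K₀ + K + 1) t = ∑ τ ∈ T K, B K t τ) :
    ∃ K₁, StringHybridNE7 S os l₀ vol (K₀ + K₁) :=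
  stringHybridNE7_closure_fed_steps S os K₀ h0 h1 hV hC hA hB hDA hDB hL0 hLs hA0 hAlo hAhi hB0 hBlo hBhi hΛ hE hρ0
    hρ1 hq hθ hθ1 (sublinearWindow_youngWindow_of_hq d Lb rr hρ0 hρ1 hq hCg hx hc) hSB hsteps hr hu hs hs₂ hZA hZB

end SchemeFedYoung

/-! ## §4 The rate seam: birth within the window ⇒ the young rate clause of `StepBudget` -/

section RateSeam

variable {θ : ℝ}

/-- **BIRTH WITHIN THE WINDOW ⇒ THE WINDOW RATE.**  For `0 < θ ≤ 1` and naturals `j ≤ b + w`: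
`θ^b ≤ θ^j·θ^{−w}` — a birth-step rate `θ^b` of a sub-history met at step `j` and born at most `w` steps earlier is
dominated by the window rate `θ^j·θ^{−w}` of `T4MatchingClosureFed.StepBudget.rate` /
`T4MatchingClosureRem.remnantYoungW`.  (`θ^b = θ^{b+w}·θ^{−w}` and `θ^{b+w} ≤ θ^j`.) [folklore] -/
theorem pow_birth_le_windowRate (hθ : 0 < θ) (hθ1 : θ ≤ 1) {j b w : ℕ} (h : j ≤ b + w) :
    θ ^ b ≤ θ ^ j * θ⁻¹ ^ w := by
  have key : θ ^ b = θ ^ (b + w) * θ⁻¹ ^ w := by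
    rw [pow_add, mul_assoc, ← mul_pow, mul_inv_cancel₀ hθ.ne', one_pow, mul_one]
  rw [key]
  exact mul_le_mul_of_nonneg_right (pow_le_pow_of_le_one hθ.le hθ1 h) (pow_nonneg (inv_nonneg.2 hθ.le) _)

/-- THE COVERING ARITHMETIC: if the sub-history met at step `j` was born at step `b` with `j ≤ b + ℓ` for a real
lifetime majorant `ℓ` (e.g. the real-cast sum of its epoch lengths), and `ℓ < W` for a natural window `W` (the
conclusion SHAPE of `T4BankAgeYoung.lifetime_lt_youngWindow`), then `j ≤ b + W`. [folklore] -/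
theorem step_le_birth_add_window {j b W : ℕ} {ℓ : ℝ} (hcover : (j : ℝ) ≤ b + ℓ) (hℓ : ℓ < (W : ℝ)) : j ≤ b + W := by
  have h : (j : ℝ) < ((b + W : ℕ) : ℝ) := by push_cast; linarith
  exact (by exact_mod_cast h : j < b + W).le

/-- **THE YOUNG RATE CLAUSE FROM A LIFETIME BOUND** (`0 < θ ≤ 1`, `0 ≤ C_r`): a birth-step rate `C_r·θ^b` with
`j ≤ b + ℓ`, `ℓ < W(K)` is at most the window rate `C_r·θ^j·θ^{−W(K)}` — the upper half of
`T4MatchingClosureFed.StepBudget.rate` at step `j` for the profile `r_j := C_r·θ^b`. [folklore] -/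
theorem youngRate_of_lifetime_lt (hθ : 0 < θ) (hθ1 : θ ≤ 1) {Cr : ℝ} (hCr : 0 ≤ Cr) {j b : ℕ} {ℓ : ℝ} {W : ℕ → ℕ}
    {K : ℕ} (hcover : (j : ℝ) ≤ b + ℓ) (hℓ : ℓ < (W K : ℝ)) : Cr * θ ^ b ≤ Cr * θ ^ j * θ⁻¹ ^ W K := by
  rw [mul_assoc]
  exact mul_le_mul_of_nonneg_left (pow_birth_le_windowRate hθ hθ1 (step_le_birth_add_window hcover hℓ)) hCr

/-- **THE RATE SEAM, BY NAME** (= `youngRate_of_lifetime_lt` with `ℓ` the lifetime `Σ_{i≤m} len_i` of a sub-history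
ledger obeying the hypotheses of `T4BankAgeYoung.lifetime_lt_youngWindow` at cutoff `K`, and `W := youngWindow …`): a
young sub-history met at step `j`, born at `b` with `j ≤ b + Σ_{i≤m} len_i` (covering binder `hcover`), carries at most
the window rate `C_r·θ^j·θ^{−youngWindow … K}`.  Every hypothesis of `lifetime_lt_youngWindow` is a BINDER here, as
there; nothing PRINTED is asserted. [folklore] -/
theorem youngRate_of_lifetime_lt_youngWindow (hθ : 0 < θ) (hθ1 : θ ≤ 1) {Cr : ℝ} (hCr : 0 ≤ Cr) {j b : ℕ}
    {ce cs p₀ bk : ℝ} {m D : ℕ} {C' : ℝ} {K : ℕ} (hce : 0 < ce) (hp : 0 < p₀) (hP5 : ce ≤ cs * p₀)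
    (hb : ce * p₀ * m + cs * p₀ ^ 2 * D ≤ bk) (hbA : bk < ce * p₀ * (ageCut C' K))
    {C : ℝ} (hC : 1 ≤ C) (d : ℕ) {Ψ f v : ℕ → ℝ} (hf : ∀ i, 0 ≤ f i) (hv : ∀ i, 0 ≤ v i) (hΨ0 : 0 ≤ Ψ 0)
    (hfound : Ψ 0 ≤ 2 * 14 ^ d * f 0)
    (hstep : ∀ i, Ψ (i + 1) ≤ C * Ψ i + (2 * 14 ^ d * f (i + 1) + 2 * d * v (i + 1)))
    (hD : ∑ i ∈ Finset.range (m + 1), f i ≤ D) (hV : ∑ i ∈ Finset.range (m + 1), v i ≤ 2 * m + D)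
    {σ : ℕ → ℝ} {d' : ℕ → ℕ → ℝ} {len : ℕ → ℕ}
    (hσ : ∀ i, i ≤ m → ∃ t, t ≤ m ∧ σ i ≤ C * Ψ t)
    (hint : ∀ i, i ≤ m → ∀ k, 0 < d' i k → 1 ≤ d' i k)
    (hhalf : ∀ i, i ≤ m → ∀ k, 1 < k → d' i k ≤ (1 / 2) ^ k * σ i)
    (F : Flow) {β' : ℝ} (hβ' : 0 ≤ β') {L r : ℕ} (hL : 1 ≤ L)
    (hpos : ∀ j, j ≤ K → 0 < F.g j) (hle1 : ∀ j, j ≤ K → F.g j ≤ 1) (hrg : F.SatisfiesRG K)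
    (hub : ∀ j, j < K → F.β (j + 1) (F.g j) ≤ β') (R : ℕ → ℕ) (hRj : ∀ j, j ≤ K → B14.IsRj L r (F.g j) (R j))
    {x c : ℝ} (hx : 0 ≤ x) (hc : 0 ≤ c) (hxK : Real.log ((F.g K) ^ 2)⁻¹ ≤ x) (hcK : (F.g K) ^ 2 * β' ≤ c)
    {s : ℕ → ℕ} (hs : ∀ i, i ≤ m → s i ≤ K)
    (hlen : ∀ i, i ≤ m → ∃ k : ℕ, (k = 0 ∨ 0 < d' i k) ∧ (len i : ℝ) ≤ k + R (s i))
    (hcover : (j : ℝ) ≤ b + ∑ i ∈ Finset.range (m + 1), (len i : ℝ)) :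
    Cr * θ ^ b ≤ Cr * θ ^ j * θ⁻¹ ^ youngWindow d L r C C' x c K :=
  youngRate_of_lifetime_lt hθ hθ1 hCr (W := youngWindow d L r C C' x c) hcover
    (lifetime_lt_youngWindow hce hp hP5 hb hbA hC d hf hv hΨ0 hfound hstep hD hV hσ hint hhalf F hβ' hL hpos hle1 hrg
      hub R hRj hx hc hxK hcK hs hlen).2

end RateSeam

/-! ## §5 Sanity: the discharged binders are jointly satisfiable; the rate seam fires on numbers -/

section Sanity

/-- SANITY (the discharged binders are jointly satisfiable with Lemma Y's window): for any `0 ≤ E₀`, `0 < ρ < 1`, `C`,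
`Λ`, `C_g ≥ 1`, `x̄, c̄ ≥ 0` there is an age-cut constant `C′ ≥ 0` with `hq`, the saturating profile is an admissible
`RemnantAgeBound`, and the canonical young window is sub-linear. [folklore] -/
theorem youngSeam_satisfiable {E₀ ρ Cg x c : ℝ} (hE : 0 ≤ E₀) (hρ0 : 0 < ρ) (hρ1 : ρ < 1) (hCg : 1 ≤ Cg)
    (hx : 0 ≤ x) (hc : 0 ≤ c) (C Λ : ℝ) (d L r : ℕ) :
    ∃ C' : ℝ, 0 ≤ C' ∧ RemnantAgeBound (fun _ n => E₀ * ρ ^ n) E₀ ρ ∧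
      ((⌈C * Real.log Λ⌉₊ : ℕ) : ℝ) + 3 ≤ C' * (-Real.log ρ) ∧ SublinearWindow (youngWindow d L r Cg C' x c) := by
  obtain ⟨C', hC', hq⟩ := exists_ageCutConst hρ0 hρ1 C Λ
  exact ⟨C', hC', remnantAgeBound_saturated hE hρ0.le, hq, sublinearWindow_youngWindow_of_hq d L r hρ0 hρ1 hq hCg hx hc⟩

/-- SANITY (the rate seam on numbers): `θ = 1/2`, born at `b = 2`, met at `j = 4`, window `w = 2`:
`(1/2)^2 ≤ (1/2)^4·2^2` (an equality). [folklore] -/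
example : (1 / 2 : ℝ) ^ 2 ≤ (1 / 2 : ℝ) ^ 4 * (1 / 2 : ℝ)⁻¹ ^ 2 :=
  pow_birth_le_windowRate (θ := 1 / 2) (by norm_num) (by norm_num) (j := 4) (b := 2) (w := 2) le_rfl

/-- SANITY (the rate seam is TIGHT at `j = b + w`): equality. [folklore] -/
example {θ : ℝ} (hθ : 0 < θ) (b w : ℕ) : θ ^ b = θ ^ (b + w) * θ⁻¹ ^ w := by
  rw [pow_add, mul_assoc, ← mul_pow, mul_inv_cancel₀ hθ.ne', one_pow, mul_one]

end Sanity

end Literature.MathematicalPhysics.QuantumFieldTheory.Balaban1983to89.T4MatchingClosureYoung
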